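import Mathlib
import Summits.Ventures.PercRepro2.ThreeTermPartConn
import Summits.Ventures.PercRepro2.HCovCubic
import Summits.Ventures.PercRepro2.TypedStarSplit

/-!
# Three-terminal parts, II: the kernel `K₃` and the per-copy pinned typed counts see a part only
through the partition of its terminals
(blind cell PercRepro2, night-3 g29, 2026-08-29; `proofs/NIGHT3-CERT.md` §38)

With `Part.conn_part_iff` (ThreeTermPartConn.lean), for marks outside the part `W` every connection
indicator of the kernel `K₃` of the covariance form (`CovForm.K3`, HCovCubic.lean) at a configuration
`x` equals the indicator of the PART GRAPH (`partEnds`: three virtual edges on the terminals) at the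
part map `pm x` — **`K3_part`**.  For the typed counts this gives the per-copy pinned identity
**`typedCount3_part`**: with the part's edges `S` (all typed) and the other typed edges `F`, the pinned
count of core + part at the part configurations `a, b, c` (supported on `S`) is the pinned count of the
part graph at the PATTERN configurations `pm a, pm b, pm c` (supported on the three virtual edges; the
bits are the three observables «`tᵢ ↔ tⱼ` inside `S`» of `a`):

  `typedCount3 F (setOn S a z) (setOn S b z) (setOn S c z) τ (K₃ ends) =
     typedCount3 F (setOn S (pm a) z) (setOn S (pm b) z) (setOn S (pm c) z) τ (K₃ (partEnds …))`

(the fibres are matched by overwriting the part: `sum_fibre_setOn`).  So the gadget law of §36.2 holds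
termwise: the part enters the typed base only through its partition law — ThreeTermPartLaw.lean groups
the terms and applies the Harris cone.  Own work; standard axioms.
-/

namespace Summit.Ventures.PercRepro2

open SepPair Block

namespace Part

/-! ## The kernel `K₃` at the part map -/

section Kernel

variable {V : Type*} {E : Type*} [DecidableEq E] {R : Type*} [Field R]

/-- **The part map with the three block observables** of the terminals. -/
noncomputable def pm (ends : E → Sym2 V) (S : Set E) [DecidablePred (· ∈ S)] (e₁ e₂ e₃ : E)
    (t₁ t₂ t₃ : V) (ω : Config E) : Config E :=
  partMap S e₁ e₂ e₃ (blockObs ends S t₁ t₂) (blockObs ends S t₁ t₃) (blockObs ends S t₂ t₃) ω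

omit [DecidableEq E] in
/-- Indicators of events related by an equivalence agree. -/
lemma indicator_one_eq_of_iff {X Y : Set (Config E)} {ω ω' : Config E} (h : ω ∈ X ↔ ω' ∈ Y) :
    X.indicator (1 : Config E → R) ω = Y.indicator 1 ω' := by
  by_cases hω : ω ∈ X
  · rw [Set.indicator_of_mem hω, Set.indicator_of_mem (h.mp hω)]
    rfl
  · rw [Set.indicator_of_notMem hω, Set.indicator_of_notMem (fun h' => hω (h.mpr h'))]

variable {ends : E → Sym2 V} {W : Set V} {t₁ t₂ t₃ : V} (hW : IsPart ends W t₁ t₂ t₃)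
  {S : Set E} [DecidablePred (· ∈ S)] (hS : ∀ e, e ∈ S ↔ e ∈ touches ends W) {e₁ e₂ e₃ : E}
  (h1 : e₁ ∈ S) (h2 : e₂ ∈ S) (h3 : e₃ ∈ S) (h12 : e₁ ≠ e₂) (h13 : e₁ ≠ e₃) (h23 : e₂ ≠ e₃)

include hW hS h1 h2 h3 h12 h13 h23

/-- The connection indicator at the part map. -/
lemma indicator_connEvent_part {p q : V} (hp : p ∉ W) (hq : q ∉ W) (x : Config E) :
    (connEvent ends p q).indicator (1 : Config E → R) x =
      (connEvent (partEnds ends S e₁ e₂ e₃ t₁ t₂ t₃) p q).indicator 1 (pm ends S e₁ e₂ e₃ t₁ t₂ t₃ x) := by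
  unfold pm
  refine indicator_one_eq_of_iff ?_
  rw [mem_connEvent, mem_connEvent]
  exact conn_part_iff hW hS h1 h2 h3 h12 h13 h23 hp hq

/-- The indicator of `Q = {a₁ ↮ a₂}` at the part map. -/
lemma indicator_avoidAll_part {a₁ a₂ : V} (ha₁ : a₁ ∉ W) (ha₂ : a₂ ∉ W) (x : Config E) :
    (avoidAll ends a₂ {a₁}).indicator (1 : Config E → R) x =
      (avoidAll (partEnds ends S e₁ e₂ e₃ t₁ t₂ t₃) a₂ {a₁}).indicator 1
        (pm ends S e₁ e₂ e₃ t₁ t₂ t₃ x) := by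
  unfold pm
  refine indicator_one_eq_of_iff ?_
  simp only [mem_avoidAll, Finset.mem_singleton, forall_eq]
  rw [conn_part_iff hW hS h1 h2 h3 h12 h13 h23 ha₂ ha₁]

/-- The indicator of `PD = Q ∩ {a₃ ∉ C₁ ∪ C₂}` at the part map. -/
lemma indicator_PDEvent_part {a₁ a₂ a₃ : V} (ha₁ : a₁ ∉ W) (ha₂ : a₂ ∉ W) (ha₃ : a₃ ∉ W)
    (x : Config E) :
    (PDEvent ends a₁ a₂ a₃).indicator (1 : Config E → R) x =
      (PDEvent (partEnds ends S e₁ e₂ e₃ t₁ t₂ t₃) a₁ a₂ a₃).indicator 1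
        (pm ends S e₁ e₂ e₃ t₁ t₂ t₃ x) := by
  unfold pm
  refine indicator_one_eq_of_iff ?_
  simp only [PDEvent, Dtilde, UnionCluster.inU, Set.mem_inter_iff, Set.mem_compl_iff, Set.mem_union,
    mem_connEvent]
  have hc := fun {p q : V} (hp : p ∉ W) (hq : q ∉ W) =>
    conn_part_iff (ω := x) hW hS h1 h2 h3 h12 h13 h23 hp hq
  rw [hc ha₁ ha₂, hc ha₃ ha₁, hc ha₃ ha₂]

/-- **The kernel `K₃` sees the part only through the partition of its terminals**: at marks outside
`W`, `K₃` of the graph at `x, y, w` is `K₃` of the part graph at the part maps. -/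
theorem K3_part {o a₁ a₂ a₃ b : V} (ho : o ∉ W) (ha₁ : a₁ ∉ W) (ha₂ : a₂ ∉ W) (ha₃ : a₃ ∉ W)
    (hb : b ∉ W) (x y w : Config E) :
    CovForm.K3 (R := R) ends o a₁ a₂ a₃ b x y w =
      CovForm.K3 (R := R) (partEnds ends S e₁ e₂ e₃ t₁ t₂ t₃) o a₁ a₂ a₃ b
        (pm ends S e₁ e₂ e₃ t₁ t₂ t₃ x) (pm ends S e₁ e₂ e₃ t₁ t₂ t₃ y)
        (pm ends S e₁ e₂ e₃ t₁ t₂ t₃ w) := by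
  unfold CovForm.K3 CovForm.sepKernel CovForm.f3 CovForm.f4 CovForm.f5 CovForm.f6 CovForm.f7 CovForm.f10
    CovForm.f11 CovForm.f12 CovForm.sigma CovForm.inU CovForm.iQ CovForm.iPD CovForm.iL CovForm.iH
  simp only [Fin.sum_univ_succ, Fin.sum_univ_zero, Matrix.cons_val_zero, Matrix.cons_val_succ, add_zero,
    indicator_connEvent_part hW hS h1 h2 h3 h12 h13 h23 ha₁ ho,
    indicator_connEvent_part hW hS h1 h2 h3 h12 h13 h23 ha₂ ho,
    indicator_connEvent_part hW hS h1 h2 h3 h12 h13 h23 ha₁ hb,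
    indicator_connEvent_part hW hS h1 h2 h3 h12 h13 h23 ha₂ hb,
    indicator_connEvent_part hW hS h1 h2 h3 h12 h13 h23 ha₁ ha₃,
    indicator_connEvent_part hW hS h1 h2 h3 h12 h13 h23 ha₂ ha₃,
    indicator_avoidAll_part hW hS h1 h2 h3 h12 h13 h23 ha₁ ha₂,
    indicator_PDEvent_part hW hS h1 h2 h3 h12 h13 h23 ha₁ ha₂ ha₃]

end Kernel

/-! ## The part map of a fibre configuration -/

section Fibre

variable {V : Type*} {E : Type*} [DecidableEq E]

/-- The part map only reads the edges of `S`. -/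
lemma pm_eq_of_eqOn (ends : E → Sym2 V) (S : Set E) [DecidablePred (· ∈ S)] (e₁ e₂ e₃ : E)
    (t₁ t₂ t₃ : V) {x a : Config E} (h : ∀ e ∈ S, x e = a e) (e : E) (he : e ∈ S) :
    pm ends S e₁ e₂ e₃ t₁ t₂ t₃ x e = pm ends S e₁ e₂ e₃ t₁ t₂ t₃ a e := by
  have hα : blockObs ends S t₁ t₂ x = blockObs ends S t₁ t₂ a := dependsOn_blockObs ends S t₁ t₂ h
  have hβ : blockObs ends S t₁ t₃ x = blockObs ends S t₁ t₃ a := dependsOn_blockObs ends S t₁ t₃ h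
  have hγ : blockObs ends S t₂ t₃ x = blockObs ends S t₂ t₃ a := dependsOn_blockObs ends S t₂ t₃ h
  unfold pm partMap
  rw [hα, hβ, hγ]
  by_cases he1 : e = e₁
  · simp [he1]
  by_cases he2 : e = e₂
  · simp [he2]
  by_cases he3 : e = e₃
  · simp [he3]
  simp [he1, he2, he3, he]

/-- Off `S` the part map is the identity (the virtual edges lie in `S`). -/
lemma pm_of_notMem (ends : E → Sym2 V) (S : Set E) [DecidablePred (· ∈ S)] {e₁ e₂ e₃ : E}
    (h1 : e₁ ∈ S) (h2 : e₂ ∈ S) (h3 : e₃ ∈ S) (t₁ t₂ t₃ : V) (x : Config E) {e : E} (he : e ∉ S) :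
    pm ends S e₁ e₂ e₃ t₁ t₂ t₃ x e = x e :=
  partMap_apply_of_notMem S _ _ _ x h1 h2 h3 he

/-- The part map of a configuration agreeing with `a` on `S` is `a`'s pattern written over `x`. -/
lemma pm_eq_setOn (ends : E → Sym2 V) (S : Finset E) {e₁ e₂ e₃ : E} (h1 : e₁ ∈ S) (h2 : e₂ ∈ S)
    (h3 : e₃ ∈ S) (t₁ t₂ t₃ : V) {x a : Config E} (h : ∀ e ∈ S, x e = a e) :
    pm ends (↑S) e₁ e₂ e₃ t₁ t₂ t₃ x = TypedStar.setOn S (pm ends (↑S) e₁ e₂ e₃ t₁ t₂ t₃ a) x := by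
  funext e
  by_cases he : e ∈ S
  · rw [TypedStar.setOn_of_mem he]
    exact pm_eq_of_eqOn ends (↑S) e₁ e₂ e₃ t₁ t₂ t₃ (fun e' he' => h e' he') e he
  · rw [TypedStar.setOn_of_not_mem he]
    exact pm_of_notMem ends (↑S) (Finset.mem_coe.2 h1) (Finset.mem_coe.2 h2) (Finset.mem_coe.2 h3)
      t₁ t₂ t₃ x he

end Fibre

/-! ## Matching fibres by overwriting the part -/

section Reindex

variable {E : Type*} [Fintype E] [DecidableEq E] {R : Type*} [CommRing R]

omit [Fintype E] in
/-- Overwriting `S` twice keeps the last value. -/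
lemma setOn_setOn (S : Finset E) (a a' x : Config E) :
    TypedStar.setOn S a (TypedStar.setOn S a' x) = TypedStar.setOn S a x := by
  funext e
  by_cases he : e ∈ S
  · simp [TypedStar.setOn_of_mem he]
  · simp [TypedStar.setOn_of_not_mem he]

omit [Fintype E] in
/-- A configuration agreeing with `setOn S a z` off `F` (`F` disjoint from `S`) is recovered from its
overwrite by `a'` by overwriting with `a` again. -/
lemma setOn_setOn_of_fibre {F S : Finset E} (hd : Disjoint F S) {z a : Config E} (a' : Config E)
    {x : Config E} (hx : ∀ e, e ∉ F → x e = TypedStar.setOn S a z e) :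
    TypedStar.setOn S a (TypedStar.setOn S a' x) = x := by
  rw [setOn_setOn]
  funext e
  by_cases he : e ∈ S
  · rw [TypedStar.setOn_of_mem he]
    have heF : e ∉ F := fun hF => Finset.disjoint_left.mp hd hF he
    rw [hx e heF, TypedStar.setOn_of_mem he]
  · rw [TypedStar.setOn_of_not_mem he]

omit [Fintype E] in
/-- Overwriting the part of a fibre configuration lands in the fibre of the overwritten base. -/
lemma fibre_setOn {F S : Finset E} {z a : Config E} (a' : Config E) {x : Config E}
    (hx : ∀ e, e ∉ F → x e = TypedStar.setOn S a z e) :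
    ∀ e, e ∉ F → TypedStar.setOn S a' x e = TypedStar.setOn S a' z e := by
  intro e heF
  by_cases he : e ∈ S
  · rw [TypedStar.setOn_of_mem he, TypedStar.setOn_of_mem he]
  · rw [TypedStar.setOn_of_not_mem he, TypedStar.setOn_of_not_mem he, hx e heF,
      TypedStar.setOn_of_not_mem he]

/-- **Matching fibres**: summing `g ∘ setOn S a'` over the configurations agreeing with `setOn S a z`
off `F` is summing `g` over those agreeing with `setOn S a' z` off `F`. -/
lemma sum_fibre_setOn {F S : Finset E} (hd : Disjoint F S) (z a a' : Config E) (g : Config E → R) :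
    (∑ x : Config E, if (∀ e, e ∉ F → x e = TypedStar.setOn S a z e) then g (TypedStar.setOn S a' x)
      else 0) =
    ∑ x : Config E, if (∀ e, e ∉ F → x e = TypedStar.setOn S a' z e) then g x else 0 := by
  rw [← Finset.sum_filter, ← Finset.sum_filter]
  refine Finset.sum_nbij' (fun x => TypedStar.setOn S a' x) (fun x => TypedStar.setOn S a x) ?_ ?_ ?_ ?_ ?_
  · intro x hx
    simp only [Finset.mem_filter, Finset.mem_univ, true_and] at hx ⊢
    exact fibre_setOn a' hx
  · intro x hx
    simp only [Finset.mem_filter, Finset.mem_univ, true_and] at hx ⊢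
    exact fibre_setOn a hx
  · intro x hx
    simp only [Finset.mem_filter, Finset.mem_univ, true_and] at hx
    exact setOn_setOn_of_fibre hd a' hx
  · intro x hx
    simp only [Finset.mem_filter, Finset.mem_univ, true_and] at hx
    exact setOn_setOn_of_fibre hd a hx
  · intro x _
    rfl

omit [Fintype E] in
/-- The open count on an edge outside `S` ignores overwrites of `S`. -/
lemma openCount_setOn_of_notMem {S : Finset E} {e : E} (he : e ∉ S) (a b c x y w : Config E) :
    openCount (TypedStar.setOn S a x) (TypedStar.setOn S b y) (TypedStar.setOn S c w) e =
      openCount x y w e := by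
  simp only [openCount, TypedStar.setOn_of_not_mem he]

omit [Fintype E] [DecidableEq E] in
/-- The pinning condition of the three copies, split. -/
lemma cond3_iff {F : Finset E} (z₁ z₂ z₃ x y w : Config E) :
    (∀ e, e ∉ F → x e = z₁ e ∧ y e = z₂ e ∧ w e = z₃ e) ↔
      (∀ e, e ∉ F → x e = z₁ e) ∧ (∀ e, e ∉ F → y e = z₂ e) ∧ (∀ e, e ∉ F → w e = z₃ e) := by
  constructor
  · intro h
    exact ⟨fun e he => (h e he).1, fun e he => (h e he).2.1, fun e he => (h e he).2.2⟩
  · rintro ⟨h1, h2, h3⟩ e he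
    exact ⟨h1 e he, h2 e he, h3 e he⟩

omit [Fintype E] [DecidableEq E] in
/-- A constant condition commutes with a finite sum. -/
lemma sum_ite_const' {ι : Type*} (s : Finset ι) (A : Prop) [Decidable A] (f : ι → R) :
    (∑ i ∈ s, if A then f i else 0) = if A then ∑ i ∈ s, f i else 0 := by
  split_ifs <;> simp

/-- **The per-copy pinned count under a change of the part configurations**: if the kernel at the
fibre configurations equals a kernel `K'` at their overwrites by `a', b', c'`, the pinned count at
`(a, b, c)` is the pinned count of `K'` at `(a', b', c')`. -/
theorem typedCount3_setOn_eq {F S : Finset E} (hd : Disjoint F S) (z : Config E) (τ : E → ℕ)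
    (a b c a' b' c' : Config E) (K K' : Config E → Config E → Config E → R)
    (hK : ∀ x y w, (∀ e, e ∉ F → x e = TypedStar.setOn S a z e) →
      (∀ e, e ∉ F → y e = TypedStar.setOn S b z e) → (∀ e, e ∉ F → w e = TypedStar.setOn S c z e) →
      K x y w = K' (TypedStar.setOn S a' x) (TypedStar.setOn S b' y) (TypedStar.setOn S c' w)) :
    TypedStar.typedCount3 F (TypedStar.setOn S a z) (TypedStar.setOn S b z) (TypedStar.setOn S c z) τ K =
      TypedStar.typedCount3 F (TypedStar.setOn S a' z) (TypedStar.setOn S b' z)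
        (TypedStar.setOn S c' z) τ K' := by
  unfold TypedStar.typedCount3
  -- the typed condition on `F` is invariant under overwriting `S`
  have hτ : ∀ x y w : Config E, (∀ e ∈ F, openCount (TypedStar.setOn S a' x) (TypedStar.setOn S b' y)
      (TypedStar.setOn S c' w) e = τ e) ↔ (∀ e ∈ F, openCount x y w e = τ e) := by
    intro x y w
    refine forall₂_congr fun e he => ?_
    rw [openCount_setOn_of_notMem (fun hS => Finset.disjoint_left.mp hd he hS)]
  -- the left-hand summand with the split conditions and the kernel identity
  have hL : ∀ x y w : Config E,
      (if (∀ e, e ∉ F → x e = TypedStar.setOn S a z e ∧ y e = TypedStar.setOn S b z e ∧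
            w e = TypedStar.setOn S c z e) ∧ (∀ e ∈ F, openCount x y w e = τ e) then K x y w else 0) =
      (if (∀ e, e ∉ F → x e = TypedStar.setOn S a z e) then
        (if (∀ e, e ∉ F → y e = TypedStar.setOn S b z e) then
          (if (∀ e, e ∉ F → w e = TypedStar.setOn S c z e) then
            (if (∀ e ∈ F, openCount (TypedStar.setOn S a' x) (TypedStar.setOn S b' y)
                (TypedStar.setOn S c' w) e = τ e) then
              K' (TypedStar.setOn S a' x) (TypedStar.setOn S b' y) (TypedStar.setOn S c' w) else 0)
          else 0) else 0) else 0) := by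
    intro x y w
    by_cases hx : ∀ e, e ∉ F → x e = TypedStar.setOn S a z e
    · by_cases hy : ∀ e, e ∉ F → y e = TypedStar.setOn S b z e
      · by_cases hw : ∀ e, e ∉ F → w e = TypedStar.setOn S c z e
        · have hc : ∀ e, e ∉ F → x e = TypedStar.setOn S a z e ∧ y e = TypedStar.setOn S b z e ∧
              w e = TypedStar.setOn S c z e := (cond3_iff _ _ _ x y w).2 ⟨hx, hy, hw⟩
          rw [if_pos hx, if_pos hy, if_pos hw]
          by_cases ht : ∀ e ∈ F, openCount x y w e = τ e
          · rw [if_pos ⟨hc, ht⟩, if_pos ((hτ x y w).2 ht), hK x y w hx hy hw]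
          · rw [if_neg (fun h => ht h.2), if_neg (fun h => ht ((hτ x y w).1 h))]
        · rw [if_neg (fun h => hw ((cond3_iff _ _ _ x y w).1 h.1).2.2), if_pos hx, if_pos hy, if_neg hw]
      · rw [if_neg (fun h => hy ((cond3_iff _ _ _ x y w).1 h.1).2.1), if_pos hx, if_neg hy]
    · rw [if_neg (fun h => hx ((cond3_iff _ _ _ x y w).1 h.1).1), if_neg hx]
  -- the right-hand summand with the split conditions
  have hR : ∀ x y w : Config E,
      (if (∀ e, e ∉ F → x e = TypedStar.setOn S a' z e ∧ y e = TypedStar.setOn S b' z e ∧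
            w e = TypedStar.setOn S c' z e) ∧ (∀ e ∈ F, openCount x y w e = τ e) then K' x y w else 0) =
      (if (∀ e, e ∉ F → x e = TypedStar.setOn S a' z e) then
        (if (∀ e, e ∉ F → y e = TypedStar.setOn S b' z e) then
          (if (∀ e, e ∉ F → w e = TypedStar.setOn S c' z e) then
            (if (∀ e ∈ F, openCount x y w e = τ e) then K' x y w else 0)
          else 0) else 0) else 0) := by
    intro x y w
    by_cases hx : ∀ e, e ∉ F → x e = TypedStar.setOn S a' z e
    · by_cases hy : ∀ e, e ∉ F → y e = TypedStar.setOn S b' z e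
      · by_cases hw : ∀ e, e ∉ F → w e = TypedStar.setOn S c' z e
        · have hc : ∀ e, e ∉ F → x e = TypedStar.setOn S a' z e ∧ y e = TypedStar.setOn S b' z e ∧
              w e = TypedStar.setOn S c' z e := (cond3_iff _ _ _ x y w).2 ⟨hx, hy, hw⟩
          rw [if_pos hx, if_pos hy, if_pos hw]
          by_cases ht : ∀ e ∈ F, openCount x y w e = τ e
          · rw [if_pos ⟨hc, ht⟩, if_pos ht]
          · rw [if_neg (fun h => ht h.2), if_neg ht]
        · rw [if_neg (fun h => hw ((cond3_iff _ _ _ x y w).1 h.1).2.2), if_pos hx, if_pos hy, if_neg hw]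
      · rw [if_neg (fun h => hy ((cond3_iff _ _ _ x y w).1 h.1).2.1), if_pos hx, if_neg hy]
    · rw [if_neg (fun h => hx ((cond3_iff _ _ _ x y w).1 h.1).1), if_neg hx]
  simp only [hL, hR, sum_ite_const']
  -- reindex the three fibres in turn
  rw [sum_fibre_setOn hd z a a' (fun x => ∑ y : Config E,
    if (∀ e, e ∉ F → y e = TypedStar.setOn S b z e) then
      (∑ w : Config E, if (∀ e, e ∉ F → w e = TypedStar.setOn S c z e) then
        (if (∀ e ∈ F, openCount x (TypedStar.setOn S b' y) (TypedStar.setOn S c' w) e = τ e) then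
          K' x (TypedStar.setOn S b' y) (TypedStar.setOn S c' w) else 0) else 0) else 0)]
  refine Finset.sum_congr rfl fun x _ => ?_
  split_ifs with hx
  · rw [sum_fibre_setOn hd z b b' (fun y => ∑ w : Config E,
      if (∀ e, e ∉ F → w e = TypedStar.setOn S c z e) then
        (if (∀ e ∈ F, openCount x y (TypedStar.setOn S c' w) e = τ e) then
          K' x y (TypedStar.setOn S c' w) else 0) else 0)]
    refine Finset.sum_congr rfl fun y _ => ?_
    split_ifs with hy
    · rw [sum_fibre_setOn hd z c c' (fun w =>
        if (∀ e ∈ F, openCount x y w e = τ e) then K' x y w else 0)]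
    · rfl
  · rfl

end Reindex

/-! ## The per-copy pinned counts of core + part are those of the part graph at the patterns -/

section Typed

variable {V : Type*} {E : Type*} [Fintype E] [DecidableEq E] {R : Type*} [Field R]

/-- **The gadget law, termwise**: with the part's edges `S` all typed and the other typed edges `F`,
the per-copy pinned count of core + part at part configurations `a, b, c` supported on `S` is the
pinned count of the part graph at the pattern configurations `pm a, pm b, pm c`. -/
theorem typedCount3_part {ends : E → Sym2 V} {W : Set V} {t₁ t₂ t₃ : V}
    (hW : IsPart ends W t₁ t₂ t₃) {S : Finset E} (hS : ∀ e, e ∈ S ↔ e ∈ touches ends W)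
    {e₁ e₂ e₃ : E} (h1 : e₁ ∈ S) (h2 : e₂ ∈ S) (h3 : e₃ ∈ S) (h12 : e₁ ≠ e₂) (h13 : e₁ ≠ e₃)
    (h23 : e₂ ≠ e₃) {o a₁ a₂ a₃ b : V} (ho : o ∉ W) (ha₁ : a₁ ∉ W) (ha₂ : a₂ ∉ W) (ha₃ : a₃ ∉ W)
    (hb : b ∉ W) {F : Finset E} (hd : Disjoint F S) (z : Config E) (τ : E → ℕ) (a b' c : Config E) :
    TypedStar.typedCount3 F (TypedStar.setOn S a z) (TypedStar.setOn S b' z) (TypedStar.setOn S c z) τ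
        (CovForm.K3 (R := R) ends o a₁ a₂ a₃ b) =
      TypedStar.typedCount3 F (TypedStar.setOn S (pm ends (↑S) e₁ e₂ e₃ t₁ t₂ t₃ a) z)
        (TypedStar.setOn S (pm ends (↑S) e₁ e₂ e₃ t₁ t₂ t₃ b') z)
        (TypedStar.setOn S (pm ends (↑S) e₁ e₂ e₃ t₁ t₂ t₃ c) z) τ
        (CovForm.K3 (R := R) (partEnds ends (↑S) e₁ e₂ e₃ t₁ t₂ t₃) o a₁ a₂ a₃ b) := by
  have hS' : ∀ e, e ∈ (↑S : Set E) ↔ e ∈ touches ends W := fun e => by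
    rw [Finset.mem_coe]; exact hS e
  have h1' : e₁ ∈ (↑S : Set E) := Finset.mem_coe.2 h1
  have h2' : e₂ ∈ (↑S : Set E) := Finset.mem_coe.2 h2
  have h3' : e₃ ∈ (↑S : Set E) := Finset.mem_coe.2 h3
  refine typedCount3_setOn_eq hd z τ a b' c _ _ _ _ _ fun x y w hx hy hw => ?_
  rw [K3_part hW hS' h1' h2' h3' h12 h13 h23 ho ha₁ ha₂ ha₃ hb x y w]
  have hxa : ∀ e ∈ S, x e = a e := fun e he => by
    have heF : e ∉ F := fun hF => Finset.disjoint_left.mp hd hF he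
    rw [hx e heF, TypedStar.setOn_of_mem he]
  have hyb : ∀ e ∈ S, y e = b' e := fun e he => by
    have heF : e ∉ F := fun hF => Finset.disjoint_left.mp hd hF he
    rw [hy e heF, TypedStar.setOn_of_mem he]
  have hwc : ∀ e ∈ S, w e = c e := fun e he => by
    have heF : e ∉ F := fun hF => Finset.disjoint_left.mp hd hF he
    rw [hw e heF, TypedStar.setOn_of_mem he]
  rw [pm_eq_setOn ends S h1 h2 h3 t₁ t₂ t₃ hxa, pm_eq_setOn ends S h1 h2 h3 t₁ t₂ t₃ hyb,
    pm_eq_setOn ends S h1 h2 h3 t₁ t₂ t₃ hwc]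

end Typed

end Part

end Summit.Ventures.PercRepro2
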